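import Summits.RiemannHypothesis.RiemannHypothesis.Theorems.SoninCertData
import Summits.RiemannHypothesis.RiemannHypothesis.Theorems.SoninBandEnergyNumerics
import Summits.RiemannHypothesis.RiemannHypothesis.Theorems.SoninBandEnergyFourier
import Literature.NumberTheory.ConnesConsani2021.SemilocalTwist
import Literature.Analysis.OperatorTheory.LpDilation
import HarnessLib

/-!
# Sonin-section certificate for `S = {∞, 2}`, II: the Sonin-side vector `η` as an element of `L²(ℝ)` (file P2)

Cell `rh-explicit`, seat cc-s2-3 (lead R7-12, Phase 2).  The data list `rL` of `SoninCertData` (file P1) is the polynomial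
`R` of degree 34 on `[1, 8]`; this file builds the even function `η(x) = R(|x|)·1_{1 ≤ |x| ≤ 8}` as a class
`eta ∈ Lp ℂ 2 volume` and proves the facts cc-s2-1's bridge
(`Theorems/SemilocalSoninLimitBridge.not_semilocalSoninIneqOn_of_bdd_witness_nearSonin`) consumes about `η`:
`eta ∈ evenPart`, `eta ∈ vanishOn 1`, `‖eta‖² = etaNormSqQ` (a rational; hence `‖eta‖ ≤ NHiQ = 24/25` and
`dQ < ‖eta‖`), and the twisted norm `‖θ₂ eta‖² = (3/2)‖η‖² − 2∫₂⁸ R(v)R(v/2) dv ≤ GmHiQ = 1`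
(from `Literature…norm_sq_primeTwist`: `‖θ_pζ‖² = (1 + p⁻¹)‖ζ‖² − 2e^{−(log p)/2} Re⟨ζ|ϑ(p)ζ⟩` with
`⟨η|ϑ(2)η⟩ = 2^{−1/2}∫ η(v)η(v/2) dv`, the two factors `e^{−(log 2)/2}` multiplying to `1/2`).  The test function
`G = gL·1_{[−b,b]}` is cc-s2-4's `polyWitness gL bQ` (no new object).  Definitions: `etaFun`, `eta` only.
No facts, no axioms.
-/

set_option linter.dupNamespace false  -- the mandated namespace repeats `RiemannHypothesis`

noncomputable section

open MeasureTheory Complex Set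
open scoped Real ComplexConjugate
open Summit.RiemannHypothesis.RiemannHypothesis.Theorems.SemilocalPolyWitness
open Summit.RiemannHypothesis.RiemannHypothesis.BandEnergy (scaleList ev_scaleList)
open Literature.NumberTheory.ConnesConsani2021

namespace Summit.RiemannHypothesis.RiemannHypothesis.SoninCert

/-! ## The function `η` -/

/-- The inner profile `x ↦ R(|x|)` for `1 ≤ |x|`, `0` for `|x| < 1` (before cutting at `|x| ≤ 8`). [folklore] -/
def etaCore (x : ℝ) : ℂ := if 1 ≤ |x| then ((LQ.ev rL |x| : ℝ) : ℂ) else 0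

/-- **The Sonin-side vector** `η(x) = R(|x|)` for `1 ≤ |x| ≤ 8`, `0` otherwise (even, vanishes on `[−1, 1]` off the
null set `{±1}`). [folklore] -/
def etaFun : ℝ → ℂ := (Icc (-8 : ℝ) 8).indicator etaCore

/-- `etaCore` is measurable. [folklore] -/
theorem measurable_etaCore : Measurable etaCore := by
  refine Measurable.ite (measurableSet_le measurable_const measurable_norm) ?_ measurable_const
  exact (Complex.continuous_ofReal.comp ((LQ.continuous_ev rL).comp continuous_norm)).measurable

/-- `etaFun` is measurable. [folklore] -/
theorem measurable_etaFun : Measurable etaFun := measurable_etaCore.indicator measurableSet_Icc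

/-- Uniform bound `‖etaCore x‖ ≤ absBound rL 8` on `[−8, 8]`. [folklore] -/
theorem norm_etaCore_le {x : ℝ} (hx : x ∈ Icc (-8 : ℝ) 8) : ‖etaCore x‖ ≤ (LQ.absBound rL 8 : ℝ) := by
  unfold etaCore
  split_ifs with h
  · rw [Complex.norm_real, Real.norm_eq_abs]
    have h8 : |(|x|)| ≤ ((8 : ℚ) : ℝ) := by
      rw [abs_abs]; push_cast; exact abs_le.2 ⟨by linarith [hx.1], hx.2⟩
    exact LQ.abs_ev_le_absBound rL h8
  · rw [norm_zero]; exact_mod_cast LQ.absBound_nonneg rL (by norm_num)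

/-- `etaFun ∈ L²(ℝ)`. [folklore] -/
theorem memLp_etaFun : MemLp etaFun 2 (volume : Measure ℝ) := by
  rw [etaFun, memLp_indicator_iff_restrict measurableSet_Icc]
  exact MemLp.of_bound measurable_etaCore.aestronglyMeasurable (LQ.absBound rL 8 : ℝ)
    ((ae_restrict_iff' measurableSet_Icc).2 (Filter.Eventually.of_forall fun x hx => norm_etaCore_le hx))

/-- `η` is even. [folklore] -/
theorem etaFun_neg (x : ℝ) : etaFun (-x) = etaFun x := by
  unfold etaFun etaCore
  have h1 : (-x ∈ Icc (-8 : ℝ) 8) ↔ (x ∈ Icc (-8 : ℝ) 8) := by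
    simp only [mem_Icc]; constructor <;> rintro ⟨h1, h2⟩ <;> constructor <;> linarith
  by_cases hx : x ∈ Icc (-8 : ℝ) 8
  · rw [indicator_of_mem (h1.2 hx), indicator_of_mem hx, abs_neg]
  · rw [indicator_of_notMem (fun h => hx (h1.1 h)), indicator_of_notMem hx]

/-- `η` vanishes on the open interval `(−1, 1)`. [folklore] -/
theorem etaFun_eq_zero_of_abs_lt {x : ℝ} (hx : |x| < 1) : etaFun x = 0 := by
  unfold etaFun etaCore
  by_cases h8 : x ∈ Icc (-8 : ℝ) 8
  · rw [indicator_of_mem h8, if_neg (not_le.2 hx)]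
  · exact indicator_of_notMem h8 _

/-- `η` vanishes off `[−8, 8]`. [folklore] -/
theorem etaFun_eq_zero_of_not_mem {x : ℝ} (hx : x ∉ Icc (-8 : ℝ) 8) : etaFun x = 0 :=
  indicator_of_notMem hx _

/-- On `1 ≤ x ≤ 8`: `η(x) = R(x)`. [folklore] -/
theorem etaFun_of_mem {x : ℝ} (hx : x ∈ Icc (1 : ℝ) 8) : etaFun x = ((LQ.ev rL x : ℝ) : ℂ) := by
  unfold etaFun etaCore
  have h8 : x ∈ Icc (-8 : ℝ) 8 := ⟨by linarith [hx.1], hx.2⟩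
  have hx0 : 0 ≤ x := by linarith [hx.1]
  rw [indicator_of_mem h8, if_pos (by rw [abs_of_nonneg hx0]; exact hx.1), abs_of_nonneg hx0]

/-- **The class** `eta ∈ L²(ℝ)` of `η`. [folklore] -/
def eta : Lp ℂ 2 (volume : Measure ℝ) := memLp_etaFun.toLp etaFun

/-- `eta = etaFun` a.e. [folklore] -/
theorem eta_coeFn : (eta : ℝ → ℂ) =ᵐ[volume] etaFun := memLp_etaFun.coeFn_toLp

/-- `eta ∈ evenPart`. [folklore] -/
theorem eta_mem_evenPart : eta ∈ evenPart := by
  rw [mem_evenPart_iff]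
  have h := eta_coeFn
  have h' : (fun x : ℝ => (eta : ℝ → ℂ) (-x)) =ᵐ[volume] fun x => etaFun (-x) :=
    (Measure.measurePreserving_neg (volume : Measure ℝ)).quasiMeasurePreserving.ae_eq_comp h
  filter_upwards [h, h'] with x hx hx'
  rw [hx', hx, etaFun_neg]

/-- `eta ∈ vanishOn 1` (it vanishes on `(−1, 1)`, and `{±1}` is null). [folklore] -/
theorem eta_mem_vanishOn : eta ∈ vanishOn 1 := by
  rw [mem_vanishOn_iff]
  have hnull : ∀ᵐ x : ℝ ∂volume, x ≠ 1 ∧ x ≠ -1 := by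
    have h1 : ∀ᵐ x : ℝ ∂volume, x ≠ 1 := by simp [ae_iff]
    have h2 : ∀ᵐ x : ℝ ∂volume, x ≠ -1 := by simp [ae_iff]
    exact h1.and h2
  filter_upwards [eta_coeFn, hnull] with x hx hne hxI
  rw [hx]
  refine etaFun_eq_zero_of_abs_lt (lt_of_le_of_ne (abs_le.2 hxI) ?_)
  intro h
  rcases abs_eq (zero_le_one) |>.1 h with h' | h'
  · exact hne.1 h'
  · exact hne.2 h'

/-! ## Norms -/

/-- `∫ ‖η‖² = 2∫₁⁸ R²`: the norm of `eta` is the rational `etaNormSqQ`. [folklore] -/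
theorem norm_eta_sq : ‖eta‖ ^ 2 = ((etaNormSqQ : ℚ) : ℝ) := by
  rw [eta, Summit.RiemannHypothesis.RiemannHypothesis.BandEnergy.norm_toLp_sq]
  -- ∫ ‖etaFun‖² over ℝ = ∫_{[−8,−1]} + ∫_{[1,8]} = 2 ∫_{[1,8]} R²
  have hsplit : (fun x => ‖etaFun x‖ ^ 2)
      = (Icc (1 : ℝ) 8).indicator (fun x => LQ.ev rL x ^ 2)
        + (Icc (-8 : ℝ) (-1)).indicator (fun x => LQ.ev rL (-x) ^ 2) := by
    funext x
    simp only [Pi.add_apply]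
    by_cases h1 : x ∈ Icc (1 : ℝ) 8
    · have h2 : x ∉ Icc (-8 : ℝ) (-1) := fun h => by linarith [h.2, h1.1]
      rw [indicator_of_mem h1, indicator_of_notMem h2, add_zero, etaFun_of_mem h1, Complex.norm_real,
        Real.norm_eq_abs, sq_abs]
    · by_cases h2 : x ∈ Icc (-8 : ℝ) (-1)
      · have h1' : -x ∈ Icc (1 : ℝ) 8 := ⟨by linarith [h2.2], by linarith [h2.1]⟩
        rw [indicator_of_notMem h1, indicator_of_mem h2, zero_add, ← etaFun_neg, etaFun_of_mem h1',
          Complex.norm_real, Real.norm_eq_abs, sq_abs]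
      · have hz : etaFun x = 0 := by
          by_cases h8 : x ∈ Icc (-8 : ℝ) 8
          · refine etaFun_eq_zero_of_abs_lt (abs_lt.2 ⟨?_, ?_⟩)
            · by_contra h; exact h2 ⟨h8.1, by linarith⟩
            · by_contra h; exact h1 ⟨by linarith, h8.2⟩
          · exact etaFun_eq_zero_of_not_mem h8
        rw [indicator_of_notMem h1, indicator_of_notMem h2, add_zero, hz, norm_zero, zero_pow two_ne_zero]
  rw [hsplit, integral_add', integral_indicator measurableSet_Icc, integral_indicator measurableSet_Icc]
  · -- the two set integrals, as interval integrals of list polynomials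
    have hI1 : ∫ x in Icc (1 : ℝ) 8, LQ.ev rL x ^ 2
        = LQ.ev (LQ.integ (LQ.mul rL rL)) 8 - LQ.ev (LQ.integ (LQ.mul rL rL)) 1 := by
      rw [integral_Icc_eq_integral_Ioc, ← intervalIntegral.integral_of_le (by norm_num : (1 : ℝ) ≤ 8)]
      have e : (fun x => LQ.ev rL x ^ 2) = fun x => LQ.ev (LQ.mul rL rL) x := by
        funext x; rw [LQ.ev_mul, sq]
      rw [e, LQ.integral_ev]
    have hI2 : ∫ x in Icc (-8 : ℝ) (-1), LQ.ev rL (-x) ^ 2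
        = LQ.ev (LQ.integ (LQ.mul rL rL)) 8 - LQ.ev (LQ.integ (LQ.mul rL rL)) 1 := by
      rw [integral_Icc_eq_integral_Ioc, ← intervalIntegral.integral_of_le (by norm_num : (-8 : ℝ) ≤ -1)]
      have e : (fun x => LQ.ev rL (-x) ^ 2) = fun x => LQ.ev (LQ.mul rL rL) (-x) := by
        funext x; rw [LQ.ev_mul, sq]
      rw [e, intervalIntegral.integral_comp_neg (fun x => LQ.ev (LQ.mul rL rL) x)]
      norm_num
      rw [LQ.integral_ev]
    rw [hI1, hI2, etaNormSqQ, XQ]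
    have e8 : LQ.ev (LQ.integ (LQ.mul rL rL)) 8 = ((LQ.evQ (LQ.integ (LQ.mul rL rL)) 8 : ℚ) : ℝ) := by
      rw [← LQ.ev_ratCast]; norm_num
    have e1 : LQ.ev (LQ.integ (LQ.mul rL rL)) 1 = ((LQ.evQ (LQ.integ (LQ.mul rL rL)) 1 : ℚ) : ℝ) := by
      rw [← LQ.ev_ratCast]; norm_num
    rw [e8, e1]; push_cast; ring
  · exact ((((LQ.continuous_ev rL).pow 2).integrableOn_Icc).integrable_indicator measurableSet_Icc)
  · exact (((((LQ.continuous_ev rL).comp continuous_neg).pow 2).integrableOn_Icc).integrable_indicator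
      measurableSet_Icc)

/-- The numerical facts of `SoninCertData.checkData` as propositions. [folklore] -/
theorem data_facts : LQ.evQ rL XQ = 0 ∧ etaNormSqQ ≤ NHiQ ^ 2 ∧ epsQ * 10000000 / 572 ≤ dQ ^ 2
    ∧ CQ * (GmHiQ + 4 * (2 * NHiQ + dQ) * dQ) < BloQ - KQ * (2 * NHiQ + dQ) * dQ ∧ 0 < bQ ∧ bQ < 5493 / 10000 := by
  have h := checkData_eq_true
  simp only [checkData, Bool.and_eq_true, decide_eq_true_eq] at h
  obtain ⟨⟨⟨⟨⟨⟨⟨-, hR⟩, -⟩, hN⟩, hd⟩, hineq⟩, hb0⟩, hb1⟩ := h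
  exact ⟨hR, hN, hd, hineq, hb0, hb1⟩

/-- `‖eta‖ ≤ NHiQ = 24/25`. [folklore] -/
theorem norm_eta_le : ‖eta‖ ≤ ((NHiQ : ℚ) : ℝ) := by
  have h1 : ‖eta‖ ^ 2 ≤ ((NHiQ : ℚ) : ℝ) ^ 2 := by
    rw [norm_eta_sq]; exact_mod_cast data_facts.2.1
  have h2 : (0 : ℝ) ≤ ((NHiQ : ℚ) : ℝ) := by rw [NHiQ]; norm_num
  exact (pow_le_pow_iff_left₀ (norm_nonneg _) h2 two_ne_zero).mp h1

/-- A kernel check: `dQ² < etaNormSqQ` (so `d < ‖η‖`). [folklore] -/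
theorem dQ_sq_lt_etaNormSqQ : dQ ^ 2 < etaNormSqQ := by
  have h : decide (dQ ^ 2 < etaNormSqQ) = true := by decide +kernel
  exact of_decide_eq_true h

/-- `dQ < ‖eta‖`. [folklore] -/
theorem dQ_lt_norm_eta : ((dQ : ℚ) : ℝ) < ‖eta‖ := by
  have h1 : ((dQ : ℚ) : ℝ) ^ 2 < ‖eta‖ ^ 2 := by rw [norm_eta_sq]; exact_mod_cast dQ_sq_lt_etaNormSqQ
  have h2 : (0 : ℝ) ≤ ((dQ : ℚ) : ℝ) := by rw [dQ]; norm_num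
  nlinarith [norm_nonneg eta, sq_nonneg (‖eta‖ - ((dQ : ℚ) : ℝ)), sq_nonneg (‖eta‖ + ((dQ : ℚ) : ℝ))]

/-! ## The twisted norm `‖θ₂ η‖²` -/

/-- `2∫₂⁸ R(v) R(v/2) dv` as a rational (`R(v/2) = ev (scaleList rL (1/2)) v`). [folklore] -/
def twistIntQ : ℚ :=
  2 * (LQ.evQ (LQ.integ (LQ.mul rL (scaleList rL (1 / 2)))) 8 - LQ.evQ (LQ.integ (LQ.mul rL (scaleList rL (1 / 2)))) 2)

/-- On `2 ≤ v ≤ 8`: `η(v/2) = R(v/2)`. [folklore] -/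
theorem etaFun_half_of_mem {v : ℝ} (hv : v ∈ Icc (2 : ℝ) 8) :
    etaFun (2⁻¹ * v) = ((LQ.ev (scaleList rL (1 / 2)) v : ℝ) : ℂ) := by
  have h : 2⁻¹ * v ∈ Icc (1 : ℝ) 8 := ⟨by linarith [hv.1], by linarith [hv.2]⟩
  rw [etaFun_of_mem h, ev_scaleList]; push_cast; ring_nf

/-- The product `conj η(v) · η(v/2)` vanishes unless `2 ≤ |v| ≤ 8`. [folklore] -/
theorem conj_etaFun_mul_half_eq_zero {v : ℝ} (h1 : v ∉ Icc (2 : ℝ) 8) (h2 : v ∉ Icc (-8 : ℝ) (-2)) :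
    conj (etaFun v) * etaFun (2⁻¹ * v) = 0 := by
  by_cases h8 : v ∈ Icc (-8 : ℝ) 8
  · have hlt : |2⁻¹ * v| < 1 := by
      rw [abs_mul, abs_of_pos (by norm_num : (0 : ℝ) < 2⁻¹)]
      have : |v| < 2 := by
        rw [abs_lt]; constructor
        · by_contra h; exact h2 ⟨h8.1, by linarith⟩
        · by_contra h; exact h1 ⟨by linarith, h8.2⟩
      linarith
    rw [etaFun_eq_zero_of_abs_lt hlt, mul_zero]
  · rw [etaFun_eq_zero_of_not_mem h8, map_zero, zero_mul]

/-- `∫ conj η(v) η(v/2) dv = 2∫₂⁸ R(v)R(v/2) dv = twistIntQ`. [folklore] -/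
theorem integral_conj_etaFun_mul_half :
    ∫ v, conj (etaFun v) * etaFun (2⁻¹ * v) = (((twistIntQ : ℚ) : ℝ) : ℂ) := by
  have hsplit : (fun v => conj (etaFun v) * etaFun (2⁻¹ * v))
      = (Icc (2 : ℝ) 8).indicator (fun v => ((LQ.ev rL v * LQ.ev (scaleList rL (1 / 2)) v : ℝ) : ℂ))
        + (Icc (-8 : ℝ) (-2)).indicator (fun v => ((LQ.ev rL (-v) * LQ.ev (scaleList rL (1 / 2)) (-v) : ℝ) : ℂ)) := by
    funext v
    simp only [Pi.add_apply]
    by_cases h1 : v ∈ Icc (2 : ℝ) 8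
    · have h2 : v ∉ Icc (-8 : ℝ) (-2) := fun h => by linarith [h.2, h1.1]
      rw [indicator_of_mem h1, indicator_of_notMem h2, add_zero, etaFun_of_mem ⟨by linarith [h1.1], h1.2⟩,
        etaFun_half_of_mem h1, Complex.conj_ofReal]; push_cast; ring
    · by_cases h2 : v ∈ Icc (-8 : ℝ) (-2)
      · have h1' : -v ∈ Icc (2 : ℝ) 8 := ⟨by linarith [h2.2], by linarith [h2.1]⟩
        rw [indicator_of_notMem h1, indicator_of_mem h2, zero_add, ← etaFun_neg v, ← etaFun_neg (2⁻¹ * v),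
          show -(2⁻¹ * v) = 2⁻¹ * (-v) by ring, etaFun_of_mem ⟨by linarith [h1'.1], h1'.2⟩, etaFun_half_of_mem h1',
          Complex.conj_ofReal]; push_cast; ring
      · rw [indicator_of_notMem h1, indicator_of_notMem h2, add_zero, conj_etaFun_mul_half_eq_zero h1 h2]
  have hc1 : Continuous fun v : ℝ => ((LQ.ev rL v * LQ.ev (scaleList rL (1 / 2)) v : ℝ) : ℂ) :=
    Complex.continuous_ofReal.comp ((LQ.continuous_ev _).mul (LQ.continuous_ev _))
  have hc2 : Continuous fun v : ℝ => ((LQ.ev rL (-v) * LQ.ev (scaleList rL (1 / 2)) (-v) : ℝ) : ℂ) :=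
    Complex.continuous_ofReal.comp (((LQ.continuous_ev _).comp continuous_neg).mul
      ((LQ.continuous_ev _).comp continuous_neg))
  rw [hsplit, integral_add' (hc1.integrableOn_Icc.integrable_indicator measurableSet_Icc)
    (hc2.integrableOn_Icc.integrable_indicator measurableSet_Icc),
    integral_indicator measurableSet_Icc, integral_indicator measurableSet_Icc, integral_complex_ofReal,
    integral_complex_ofReal]
  have hI : ∀ (u w : ℝ), ∫ v in u..w, LQ.ev rL v * LQ.ev (scaleList rL (1 / 2)) v
      = LQ.ev (LQ.integ (LQ.mul rL (scaleList rL (1 / 2)))) w - LQ.ev (LQ.integ (LQ.mul rL (scaleList rL (1 / 2)))) u := by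
    intro u w
    have e : (fun v => LQ.ev rL v * LQ.ev (scaleList rL (1 / 2)) v) = fun v => LQ.ev (LQ.mul rL (scaleList rL (1 / 2))) v := by
      funext v; rw [LQ.ev_mul]
    rw [e, LQ.integral_ev]
  have hI1 : ∫ v in Icc (2 : ℝ) 8, LQ.ev rL v * LQ.ev (scaleList rL (1 / 2)) v
      = LQ.ev (LQ.integ (LQ.mul rL (scaleList rL (1 / 2)))) 8 - LQ.ev (LQ.integ (LQ.mul rL (scaleList rL (1 / 2)))) 2 := by
    rw [integral_Icc_eq_integral_Ioc, ← intervalIntegral.integral_of_le (by norm_num : (2 : ℝ) ≤ 8), hI]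
  have hI2 : ∫ v in Icc (-8 : ℝ) (-2), LQ.ev rL (-v) * LQ.ev (scaleList rL (1 / 2)) (-v)
      = LQ.ev (LQ.integ (LQ.mul rL (scaleList rL (1 / 2)))) 8 - LQ.ev (LQ.integ (LQ.mul rL (scaleList rL (1 / 2)))) 2 := by
    rw [integral_Icc_eq_integral_Ioc, ← intervalIntegral.integral_of_le (by norm_num : (-8 : ℝ) ≤ -2),
      intervalIntegral.integral_comp_neg (fun v => LQ.ev rL v * LQ.ev (scaleList rL (1 / 2)) v)]
    norm_num
    exact hI 2 8
  rw [hI1, hI2, twistIntQ]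
  have e8 : LQ.ev (LQ.integ (LQ.mul rL (scaleList rL (1 / 2)))) 8
      = ((LQ.evQ (LQ.integ (LQ.mul rL (scaleList rL (1 / 2)))) 8 : ℚ) : ℝ) := by rw [← LQ.ev_ratCast]; norm_num
  have e2 : LQ.ev (LQ.integ (LQ.mul rL (scaleList rL (1 / 2)))) 2
      = ((LQ.evQ (LQ.integ (LQ.mul rL (scaleList rL (1 / 2)))) 2 : ℚ) : ℝ) := by rw [← LQ.ev_ratCast]; norm_num
  rw [e8, e2]; push_cast; ring

/-- `⟨η | ϑ(2) η⟩ = e^{−(log 2)/2} · twistIntQ`. [folklore] -/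
theorem scalingCoeff_eta_log_two :
    scalingCoeff (eta : ℝ → ℂ) (eta : ℝ → ℂ) (Real.log 2)
      = (Real.exp (-(Real.log 2) / 2) : ℂ) * (((twistIntQ : ℚ) : ℝ) : ℂ) := by
  unfold scalingCoeff
  have hexp : Real.exp (-Real.log 2) = 2⁻¹ := by rw [Real.exp_neg, Real.exp_log (by norm_num : (0 : ℝ) < 2)]
  have h1 := eta_coeFn
  have h2 : (fun v : ℝ => (eta : ℝ → ℂ) (2⁻¹ * v)) =ᵐ[volume] fun v => etaFun (2⁻¹ * v) :=
    (Literature.Analysis.OperatorTheory.quasiMeasurePreserving_smul' (V := ℝ) (by norm_num : (2⁻¹ : ℝ) ≠ 0)).ae_eq h1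
  rw [← integral_conj_etaFun_mul_half, ← integral_const_mul]
  refine integral_congr_ae ?_
  filter_upwards [h1, h2] with v hv hv2
  rw [hv, hexp, hv2]
  ring

/-- **The twisted norm is a rational**: `‖θ₂ η‖² = (3/2)‖η‖² − twistIntQ`. [folklore] -/
theorem norm_sq_primeTwist_eta :
    ‖primeTwist 2 eta‖ ^ 2 = (((3 / 2 : ℚ) * etaNormSqQ - twistIntQ : ℚ) : ℝ) := by
  have h := norm_sq_primeTwist 2 eta
  simp only [Nat.cast_ofNat] at h
  rw [h, scalingCoeff_eta_log_two, norm_eta_sq]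
  have hre : ((Real.exp (-(Real.log 2) / 2) : ℂ) * (((twistIntQ : ℚ) : ℝ) : ℂ)).re
      = Real.exp (-(Real.log 2) / 2) * ((twistIntQ : ℚ) : ℝ) := by
    rw [← Complex.ofReal_mul, Complex.ofReal_re]
  have hsq : Real.exp (-(Real.log 2 / 2)) * Real.exp (-(Real.log 2) / 2) = 2⁻¹ := by
    rw [← Real.exp_add, show -(Real.log 2 / 2) + -(Real.log 2) / 2 = -Real.log 2 by ring, Real.exp_neg,
      Real.exp_log (by norm_num : (0 : ℝ) < 2)]
  rw [hre, show (2 : ℝ) * Real.exp (-(Real.log 2 / 2)) * (Real.exp (-(Real.log 2) / 2) * ((twistIntQ : ℚ) : ℝ))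
      = 2 * (Real.exp (-(Real.log 2 / 2)) * Real.exp (-(Real.log 2) / 2)) * ((twistIntQ : ℚ) : ℝ) by ring, hsq]
  push_cast
  ring

/-- A kernel check: `(3/2)·etaNormSqQ − twistIntQ ≤ GmHiQ`. [folklore] -/
theorem gm_le_GmHiQ : (3 / 2 : ℚ) * etaNormSqQ - twistIntQ ≤ GmHiQ := by
  have h : decide ((3 / 2 : ℚ) * etaNormSqQ - twistIntQ ≤ GmHiQ) = true := by decide +kernel
  exact of_decide_eq_true h

/-- **`‖θ₂ η‖² ≤ GmHiQ = 1`** (the bridge's `Gm` budget). [folklore] -/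
theorem norm_sq_primeTwist_eta_le : ‖primeTwist 2 eta‖ ^ 2 ≤ ((GmHiQ : ℚ) : ℝ) := by
  rw [norm_sq_primeTwist_eta]; exact_mod_cast gm_le_GmHiQ


end Summit.RiemannHypothesis.RiemannHypothesis.SoninCert
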